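import Summits.PneNP.PneNP.Theses.RamseyThreshold

/-!
# Route RamseyThreshold — `QuietPlantingImpliesHypothesis` (stmt-PneNP-2056)

Glue `U → X`: a quiet non-arrowing planting refutes every sound polynomial-time arrowing certifier accepting
`G(n, n^{δ-2/5})` with probability `≥ 1/2`. Soundness and support-on-non-arrowing graphs force acceptance
probability `0` under the planting (`PMF.toOuterMeasure_apply_eq_zero_iff`), the random graph is accepted with
probability `≥ 1/2` eventually, so the acceptance gap is `≤ -1/2` eventually and cannot tend to `0`.
-/

set_option linter.dupNamespace false -- `Summit.PneNP.PneNP.…`: summit = sub-problem name (D-0017 single-conjunct layout)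

namespace Summit.PneNP.PneNP.Theorems

open Filter

/-- **stmt-PneNP-2056** `QuietPlantingImpliesHypothesis`: `QuietNonArrowingPlanting → RandomRamseyHypothesis`
(Feige-style bookkeeping: a sound certifier has acceptance probability `0` on a law supported on non-arrowing
graphs, so an acceptance gap tending to `0` is incompatible with accepting `G(n,p)` with probability `≥ 1/2`).
[cite: Feige2002, §1] -/
theorem ramseyThreshold_quietPlantingImpliesHypothesis_proof :
    Summit.PneNP.PneNP.Theses.RamseyThreshold.QuietPlantingImpliesHypothesis := by
  unfold Summit.PneNP.PneNP.Theses.RamseyThreshold.QuietPlantingImpliesHypothesis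
    Summit.PneNP.PneNP.Theses.RamseyThreshold.QuietNonArrowingPlanting
    Summit.PneNP.PneNP.Theses.RamseyThreshold.RandomRamseyHypothesis
  intro hQ δ hδ hδ' ⟨f, hf, hsound, hacc⟩
  obtain ⟨P, hsupp, hquiet⟩ := hQ δ hδ hδ'
  have hT := hquiet f hf
  -- acceptance probability 0 under the planting
  have hP0 : ∀ n : ℕ, ((P n).toOuterMeasure
      {G | f (Literature.Computability.Complexity.encodingGraph.encode ⟨n, G⟩) = true}).toReal = 0 := by
    intro n
    rw [ENNReal.toReal_eq_zero_iff]
    left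
    rw [PMF.toOuterMeasure_apply_eq_zero_iff]
    rw [Set.disjoint_left]
    intro G hG hGf
    obtain ⟨c, hc⟩ := hsupp n G hG
    obtain ⟨S, hS, b, hb⟩ := hsound n G hGf c
    obtain ⟨u, hu, v, hv, huv, hne⟩ := hc S hS b
    exact hne (hb u hu v hv huv)
  -- the gap is ≤ -1/2 eventually
  have hev : ∀ᶠ n : ℕ in atTop, ((P n).toOuterMeasure
      {G | f (Literature.Computability.Complexity.encodingGraph.encode ⟨n, G⟩) = true}).toReal -
      ((((Literature.Probability.RandomGraphs.PlantedClique.bernoulliVec (n * n)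
        (min 1 (ENNReal.ofReal ((n : ℝ) ^ (δ - 2 / 5)))) (min_le_left _ _)).map
        (fun s => SimpleGraph.fromRel fun i j : Fin n => i < j ∧ s (finProdFinEquiv (i, j)) = true))).toOuterMeasure
        {G | f (Literature.Computability.Complexity.encodingGraph.encode ⟨n, G⟩) = true}).toReal ≤ -(1 / 2 : ℝ) := by
    filter_upwards [hacc] with n hn
    rw [hP0 n, zero_sub, neg_le_neg_iff]
    have hne : (((Literature.Probability.RandomGraphs.PlantedClique.bernoulliVec (n * n)
        (min 1 (ENNReal.ofReal ((n : ℝ) ^ (δ - 2 / 5)))) (min_le_left _ _)).map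
        (fun s => SimpleGraph.fromRel fun i j : Fin n => i < j ∧ s (finProdFinEquiv (i, j)) = true))).toOuterMeasure
        {G | f (Literature.Computability.Complexity.encodingGraph.encode ⟨n, G⟩) = true} ≠ ⊤ :=
      ne_top_of_le_ne_top ENNReal.one_ne_top (le_of_le_of_eq (MeasureTheory.OuterMeasure.mono _ (Set.subset_univ _))
        ((PMF.toOuterMeasure_apply_eq_one_iff _ _).2 (Set.subset_univ _)))
    have h := (ENNReal.toReal_le_toReal (by simp) hne).2 hn
    simpa using h
  -- contradiction with the gap tending to 0
  have hlim := hT.eventually (Ioi_mem_nhds (show (-(1 / 2 : ℝ)) < 0 by norm_num))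
  obtain ⟨n, hn1, hn2⟩ := (hev.and hlim).exists
  exact absurd (lt_of_lt_of_le hn2 hn1) (lt_irrefl _)

end Summit.PneNP.PneNP.Theorems
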